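import Summits.QuantumFields.YangMills.Theorems.BalabanUVNodesN12AtTheta13OfThm1CCMWGenericDoorWindowGuard
import Summits.QuantumFields.YangMills.Theorems.BalabanUVNodesN12AtRecord13Prop1KnitThm1OfRecord
import Literature.MathematicalPhysics.QuantumFieldTheory.Balaban1983to89.B15Prop1EndpointFromWindowDirectPackage

/-!
# BalabanUVNodes ∕ N12 — «12X-W-DIRECT»: the WINDOW-GUARDED N12 socket at a door below `e⁻³`, every layer letter an object of record, Prop. 1 ON THE DIRECT ROAD (plan g87
# (b-direct), pen (P3)) — keyed BY NAME on the lane's (ii⁰)_direct endpoint, the (WD) window∕direct letter package displayed per instance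

Cell `pub-ymgap` (HUMAN RULINGS D-0062 ∕ D-0149), seat `pub-ymgap-dag-n12-d` g19 (R134 N12 [B15] s2 = by-name knit at the record; pen (P3) of YMPLAN-G87-N12-ROAD); count-neutral
helper of K1⁹ `stmt-QuantumFields-27364` (`--kind proof --supports … --as helper`).  THEOREMS ONLY (0 `def`, 0 `instance`, 0 `sorry`); composition BY NAME.

WHAT.  The DIRECT-road sibling of «12X-W v8» (p648655, road (a)) and «12X-W-CLASS»: the same window-guarded N12 socket
`∃ γ₁₂ > 0, ∃ lamW, ∀ P, lamW.kSel P < P.K → Step.InInterval γ₁₂ P.K (gOfRecord₁₃ F 2 θW P) → B15Leaf (WOfRecord₁₃ F 2 θW lamW P)` at the door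
`θ₁₅ᶜᶜᴹᵂ(j;γ;ε₀,ε₂₉;B₃,B₃',a₀,a₁)`, its Prop-1 rows keyed on dag-n12-c g20's (ii⁰)_direct `B15Prop1EndpointFromWindowDirectPackage` ((ii) p636846 with gauge letter ∕
chart letter ∕ `N` ∕ package producer replaced by the displayed (WD) family letter `hWD` and `hsm` at the direct constant).

WHAT N12 COSTS HERE (kernel = the binder list): per in-window run with `1 ≤ K`: live-mass at the top slot · levels `N₀ ≤ Nm`, `N₀ ≤ K` · situation residual numbers · `hC` + `hMl` ·
`hβhist` · `Λ ≠ ∅` · four ℍ-leaves + (1.80); per run ∕ instance: structure ∕ boxes · guard `eR` · (J0′) `hMin` at `eR` · `Kb hK1 hKn` · `ρn hρn` · `γ₈ cJ bx` · the coercivity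
constant `γc` (`hγc : 0 ≤ γc P`) · the (WD) WINDOW∕DIRECT LETTER PACKAGE `hWD` at `δc εc μc Kc τc` (`hδc0 hεc0 hμc0`) · numerics `hsm hγle` · `cE cA hcE0 hcE heRa hcA hcJ'` ·
geometry `hZ1 hZblk hdiv` · `hbxM hM hR h𝓐₀`; door: `hγ₀ hγh hB hB' ha₀ ha₁ hbox' hβ' hγe h15`, `1 ≤ j` (`M₁ = L^j ≥ 2`, `εreg = a₀` are the door's).  NO gauge letter, NO chart
letter, NO topological hypothesis on `Ω₁(Z)`; the direct road's open gap is pen (P4) (H1-loc + F-multilocal) inside (WD)'s future producer.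

HONEST FRAMING ∕ LOCATED.  Bookkeeping by name; CONDITIONAL on the displayed rows; a currency edition (per-instance constants); nothing of Bałaban's asserted; N12 NOT
discharged; K0⁷ ∕ K1⁹ NOT closed; counts unmoved; one finite 𝕋⁴ programme at fixed `ε = L^{-K}` — R4 closes only the conditional rung `BalabanLadder.UV`; no summit
statement is proved here and NOT the Yang–Mills mass gap (Clay); nothing continuum ∕ ℝ⁴ ∕ OS.

References: [Balaban1989LargeFieldI] CMP 122 (1989) 175–202; [Balaban1989LargeFieldII] CMP 122 (1989) 355–392; [Balaban1988Convergent] CMP 119 (1988) 243–285;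
[Balaban1985Variational] CMP 102 (1985) 277–309; [Balaban1987RG1] CMP 109 (1987) 249–301 (locators in the theorem docstring).
-/

noncomputable section
open MeasureTheory Set Finset Metric Filter
open scoped Matrix.Norms.L2Operator BigOperators Matrix RealInnerProductSpace Real InnerProductSpace Topology

namespace Summit.QuantumFields.YangMills.BalabanUVNodes.N12AtTheta13OfThm1CCMWGenericDoorWindowGuardPinLFWindowDirect

open Literature.MathematicalPhysics.QuantumFieldTheory.Balaban1983to89
open Literature.MathematicalPhysics.QuantumFieldTheory.Balaban1983to89.T4Continuum (T4Family LStep Letter walk walkEnd netDisp holAt)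
open Literature.MathematicalPhysics.QuantumFieldTheory.Balaban1983to89.DagBinding
open Literature.MathematicalPhysics.QuantumFieldTheory.Balaban1983to89.Node00
open FlowStep (prefixOf BetaLowerH BetaUpperH)
open B15Claim189Assembly (Setting189 new189 chiPP dom half)
open B15 (Prop1Printed Ineq180)
open B15.BasicStep (Claim189)
open B15.PrelimIntegrations (Ineq191 Ineq195)
open B15Chi124DetSets (E124)
open B14DomainGeom (Pt)
open B8Eq17ClassAkV1 (plaqsOf)
open B14.Eq216Concrete (inputs)
open GaugeGroup (dist1)
open GaugeField (plaqHol gaugeAct)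
open B15Claim189PrintedConditions (omegaOfChain)
open B15Claim189PinsOfHistory (N0OfRecord₁₃)
open B15Claim189LambdaPin (enlD)
open B15RPrime1100OfRep (rPrimeDataOfSel)
open Summit.QuantumFields.YangMills.BalabanUVNodes.N12AtRecord13Prop1KnitThm1OfRecord (thm1TorusClass_of_variationalThm1RegSepCoP7M)
open Summit.QuantumFields.YangMills.BalabanUVNodes.N12AtTheta13OfThm1CCMWGenericDoorWindowGuard (exists_gamma_residW_b15Leaf_window_theta13OfThm1CCMW_topLevel_pinnedΛΩχZ_of_massLive)
open T4CubeChartGnomonic (SU2)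
open B15Prop1ChartSU2 (su2Chart)
open B15Prop1SliceCoordinates (GaugeSlice ιA)
open T4AxialGaugeSmallField (castSite boxPlaqs boxBonds)
open B6BondElimination (unitVec)
open B6TreeGaugePoincare (curl)
open B16Eq18Proof (box)
open B15Extension193 (extend)
open B15ShellGauge193 (shellGauge)
open B15Sect1Instances (fun177std)
open B14.Eq213DetSet (Bj maxDomT)
open B14.Eq213MaximalDomains (side)
open B14.Eq22Determines (blockIter IsBlockUnion)
open Literature.MathematicalPhysics.QuantumFieldTheory.BalabanImbrieJaffe1984to88.BIJ85Eq453GaugeField (qsstarGIter0)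
open B16Sect1Backgrounds (expMul toMS)
open B15DeterminingSets (pts DetBackground genSet IsMinimizer MSField avgFamily bondsOf DetSet embIter)
open B5Eq118OneStroke (iterBlockOf)
open ExpMeanLog (deltaSU)
open B15Prop1Carrier (lfVarOn InstOn InstOn.std plaqsInside)
open Literature.MathematicalPhysics.QuantumFieldTheory.Balaban1983to89.B15Prop1EndpointFromWindowDirectPackage (exists_domain_prop1Printed_lfVarOn_std_su2_box_intrinsic_analytic_atZSeqCoPRecord_ofThm1TorusClass_ofMinimiserFamily_ofWindowDirectPackage_ofCoercive)
open T4AdjointCovarianceUnitary (lieSU)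
open B15Prop1GradientFromNearValueAtCoPRecord (far_letter_of_box)
open B15Prop1AnalyticExtClause (cplxVec anExt)
open B15Prop1ChartCalculusSU2 (E3)

variable {F : T4Family}

/-! ## §2 «12X-W-DIRECT» AT THE GENERIC DOOR-CURED WINDOW-EDITION WITNESS, DOOR BELOW `e⁻³`: the window-guarded socket, every layer letter an object of record, Prop. 1 from the DIRECT-road endpoint (ii⁰)_direct -/

section WindowRoadPinLF
variable {j : ℕ} {γ ε₀ ε₂₉ B₃ B₃' a₀ a₁ : ℝ} (lam : ResidW F 2) (σ : ∀ P : B12.RunParams, Sit189 F 2 P.K)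
  (s : ∀ P : B12.RunParams, SeqOfRecord F (theta13OfThm1CCMW F 2 j γ ε₀ ε₂₉ B₃ B₃' a₀ a₁).ν (theta13OfThm1CCMW F 2 j γ ε₀ ε₂₉ B₃ B₃' a₀ a₁).τ9.M (gOfRecord₁₃ F 2 (theta13OfThm1CCMW F 2 j γ ε₀ ε₂₉ B₃ B₃' a₀ a₁) P) P.K (P.K - 1 + 1)) (Nm : B12.RunParams → ℕ) (p₁ : ℕ)

/-- **★★★ THE WINDOW-GUARDED N12 SOCKET AT A DOOR BELOW `e⁻³`, EVERY LETTER OF THE LAYER AN OBJECT OF RECORD, PROP. 1 ON THE DIRECT ROAD** — the window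
edition keyed on dag-n12-c g20's (ii⁰)_direct `B15Prop1EndpointFromWindowDirectPackage` (the (WD) letter package `hWD` at `δc εc μc Kc τc`, the coercivity constant `γc`,
numerics `hsm hγle`, `Kb`, guard `eR`, `ρn hρn`, `cE cA cJ` rows DISPLAYED per run ∕ instance; no gauge ∕ chart letter, no topological hypothesis on `Ω₁(Z)`): [cite: Balaban1989LargeFieldI, (0.1)–(0.6) pp.175–176, (1.2) p.178, (1.74) p.192, Prop. 1 (1.77)–(1.78) p.194 («for ε > 0 sufficiently small»), (1.79)–(1.80) p.195, (1.89) p.198, (1.91)–(1.97) pp.198–199, (1.99)–(1.102) pp.200–201; Balaban1989LargeFieldII, p.357, (1.7)–(1.13) pp.358–359, (1.17)–(1.19) pp.360–361; Balaban1988Convergent, (2.1)–(2.9) pp.254–256, (2.17)–(2.18) p.257, (3.16)–(3.25) pp.268–270; Balaban1985Variational, Thm 1 (8) p.279, (16)–(18) p.280; Balaban1987RG1, Thm 1 p.259, (0.20) p.256] -/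
theorem exists_gamma_residW_b15Leaf_window_theta13OfThm1CCMW_pinLF_pinnedΛΩχZ_of_massLive_windowDirect
    (hγ₀ : 0 < γ) (hγh : γ ≤ 1 / 2) (hB : 0 ≤ B₃) (hB' : 0 ≤ B₃') (ha₀ : 0 < a₀) (ha₁ : 0 < a₁)
    {β' : ℝ} (hbox' : BetaUpperH β' γ (betaOfRecord₁₃ F 2 (theta13OfThm1CCMW F 2 j γ ε₀ ε₂₉ B₃ B₃' a₀ a₁))) (hβ' : β' * γ ^ 2 ≤ 3 / 4) (hγe : γ ≤ Real.exp (-3))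
    (D : ∀ P : B12.RunParams, Setting189 (F.P P.K) (SU 2) (MSField (F.P P.K) (SU 2) × ((j : ℕ) → VecField (F.P P.K) j (EuclideanSpace ℝ (Fin (2 ^ 2 - 1))))) (Pt (F.P P.K).d))
    (hD : ∀ P : B12.RunParams, D P = ((({ lam with kSel := fun P : B12.RunParams => P.K - 1, D1100 := fun P : B12.RunParams => rPrimeDataOfSel (reprTOfRecord₁₃ F 2 (theta13OfThm1CCMW F 2 j γ ε₀ ε₂₉ B₃ B₃' a₀ a₁) P (P.K - 1)) ((theta13OfThm1CCMW F 2 j γ ε₀ ε₂₉ B₃ B₃' a₀ a₁).ppSel P (gOfRecord₁₃ F 2 (theta13OfThm1CCMW F 2 j γ ε₀ ε₂₉ B₃ B₃' a₀ a₁) P) (P.K - 1 + 1)) (fibOfSeq F (theta13OfThm1CCMW F 2 j γ ε₀ ε₂₉ B₃ B₃' a₀ a₁).ν (theta13OfThm1CCMW F 2 j γ ε₀ ε₂₉ B₃ B₃' a₀ a₁).τ9 P (gOfRecord₁₃ F 2 (theta13OfThm1CCMW F 2 j γ ε₀ ε₂₉ B₃ B₃' a₀ a₁) P) (P.K - 1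 + 1)) } : ResidW F 2).pinRPrime₁₃ (theta13OfThm1CCMW F 2 j γ ε₀ ε₂₉ B₃ B₃' a₀ a₁)).pinD189ΛH (theta13OfThm1CCMW F 2 j γ ε₀ ε₂₉ B₃ B₃' a₀ a₁).ν (theta13OfThm1CCMW F 2 j γ ε₀ ε₂₉ B₃ B₃' a₀ a₁).A₁ (theta13OfThm1CCMW F 2 j γ ε₀ ε₂₉ B₃ B₃' a₀ a₁).τ9.M (gOfRecord₁₃ F 2 (theta13OfThm1CCMW F 2 j γ ε₀ ε₂₉ B₃ B₃' a₀ a₁)) (fun P => (((((σ P).pinZres (theta13OfThm1CCMW F 2 j γ ε₀ ε₂₉ B₃ B₃' a₀ a₁).ν (theta13OfThm1CCMW F 2 j γ ε₀ ε₂₉ B₃ B₃' a₀ a₁).τ9.M (gOfRecord₁₃ F 2 (theta13OfThm1CCMW F 2 j γ ε₀ ε₂₉ B₃ B₃' a₀ a₁) P) (s P) (N0OfRecord₁₃ (theta13OfThm1CCMW F 2 j γ ε₀ ε₂₉ B₃ B₃' a₀ a₁) P (P.K - 1 + 1))).pinSides (theta13OfThm1CCMW F 2 j γ ε₀ ε₂₉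 B₃ B₃' a₀ a₁).ν (gOfRecord₁₃ F 2 (theta13OfThm1CCMW F 2 j γ ε₀ ε₂₉ B₃ B₃' a₀ a₁) P) (P.K - 1 + 1 - Nm P) (P.K - 1 + 1)).pinXΩ4 (s P) (enlD F (theta13OfThm1CCMW F 2 j γ ε₀ ε₂₉ B₃ B₃' a₀ a₁).ν (theta13OfThm1CCMW F 2 j γ ε₀ ε₂₉ B₃ B₃' a₀ a₁).τ9.M P (gOfRecord₁₃ F 2 (theta13OfThm1CCMW F 2 j γ ε₀ ε₂₉ B₃ B₃' a₀ a₁) P))).pinOmegaPP (s P) (Nm P) (enlD F (theta13OfThm1CCMW F 2 j γ ε₀ ε₂₉ B₃ B₃' a₀ a₁).ν (theta13OfThm1CCMW F 2 j γ ε₀ ε₂₉ B₃ B₃' a₀ a₁).τ9.M P (gOfRecord₁₃ F 2 (theta13OfThm1CCMW F 2 j γ ε₀ ε₂₉ B₃ B₃' a₀ a₁) P)))) s Nm p₁).D189 P)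
    (hmassLive : ∀ P : B12.RunParams, 1 ≤ P.K → Step.InInterval γ P.K (gOfRecord₁₃ F 2 (theta13OfThm1CCMW F 2 j γ ε₀ ε₂₉ B₃ B₃' a₀ a₁) P) → ∀ a, LiveSeq F 2 (theta13OfThm1CCMW F 2 j γ ε₀ ε₂₉ B₃ B₃' a₀ a₁).ν (theta13OfThm1CCMW F 2 j γ ε₀ ε₂₉ B₃ B₃' a₀ a₁).τ9 P (gOfRecord₁₃ F 2 (theta13OfThm1CCMW F 2 j γ ε₀ ε₂₉ B₃ B₃' a₀ a₁) P) (P.K - 1 + 1)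
        (slotsTOfRecord F 2 (theta13OfThm1CCMW F 2 j γ ε₀ ε₂₉ B₃ B₃' a₀ a₁).ν (theta13OfThm1CCMW F 2 j γ ε₀ ε₂₉ B₃ B₃' a₀ a₁).τ9 (EOfRecord₁₃ F 2 (theta13OfThm1CCMW F 2 j γ ε₀ ε₂₉ B₃ B₃' a₀ a₁)) (wOfRecord₉ F 2 (theta13OfThm1CCMW F 2 j γ ε₀ ε₂₉ B₃ B₃' a₀ a₁).toStage9Params)
          (theta13OfThm1CCMW F 2 j γ ε₀ ε₂₉ B₃ B₃' a₀ a₁).ppSel P (gOfRecord₁₃ F 2 (theta13OfThm1CCMW F 2 j γ ε₀ ε₂₉ B₃ B₃' a₀ a₁) P) (P.K - 1 + 1)) a →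
      0 < ∫ V, rterm (reprTOfRecord₁₃ F 2 (theta13OfThm1CCMW F 2 j γ ε₀ ε₂₉ B₃ B₃' a₀ a₁) P (P.K - 1)) a V ∂(fieldMeasure (F.P P.K) (P.K - 1 + 1) (SU 2)))
    (hNN : ∀ P : B12.RunParams, 1 ≤ P.K → Step.InInterval γ P.K (gOfRecord₁₃ F 2 (theta13OfThm1CCMW F 2 j γ ε₀ ε₂₉ B₃ B₃' a₀ a₁) P) → N0OfRecord₁₃ (theta13OfThm1CCMW F 2 j γ ε₀ ε₂₉ B₃ B₃' a₀ a₁) P (P.K - 1 + 1) ≤ Nm P)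
    (hNk : ∀ P : B12.RunParams, 1 ≤ P.K → Step.InInterval γ P.K (gOfRecord₁₃ F 2 (theta13OfThm1CCMW F 2 j γ ε₀ ε₂₉ B₃ B₃' a₀ a₁) P) → N0OfRecord₁₃ (theta13OfThm1CCMW F 2 j γ ε₀ ε₂₉ B₃ B₃' a₀ a₁) P (P.K - 1 + 1) ≤ P.K - 1 + 1)
    (hβ0 : ∀ P : B12.RunParams, 1 ≤ P.K → Step.InInterval γ P.K (gOfRecord₁₃ F 2 (theta13OfThm1CCMW F 2 j γ ε₀ ε₂₉ B₃ B₃' a₀ a₁) P) → 0 ≤ (σ P).β)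
    (hβ : ∀ P : B12.RunParams, 1 ≤ P.K → Step.InInterval γ P.K (gOfRecord₁₃ F 2 (theta13OfThm1CCMW F 2 j γ ε₀ ε₂₉ B₃ B₃' a₀ a₁) P) → (σ P).β ≤ 1 / 4)
    (hL₀ : ∀ P : B12.RunParams, 1 ≤ P.K → Step.InInterval γ P.K (gOfRecord₁₃ F 2 (theta13OfThm1CCMW F 2 j γ ε₀ ε₂₉ B₃ B₃' a₀ a₁) P) → 2 ≤ (σ P).L₀)
    (hL₀L : ∀ P : B12.RunParams, 1 ≤ P.K → Step.InInterval γ P.K (gOfRecord₁₃ F 2 (theta13OfThm1CCMW F 2 j γ ε₀ ε₂₉ B₃ B₃' a₀ a₁) P) → (σ P).L₀ ^ 2 ≤ ((F.P P.K).L : ℝ))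
    (hOB : ∀ P : B12.RunParams, 1 ≤ P.K → Step.InInterval γ P.K (gOfRecord₁₃ F 2 (theta13OfThm1CCMW F 2 j γ ε₀ ε₂₉ B₃ B₃' a₀ a₁) P) → 0 ≤ (σ P).O1 * (σ P).B₃ * (σ P).B₅)
    (hδ : ∀ P : B12.RunParams, 1 ≤ P.K → Step.InInterval γ P.K (gOfRecord₁₃ F 2 (theta13OfThm1CCMW F 2 j γ ε₀ ε₂₉ B₃ B₃' a₀ a₁) P) → 0 ≤ (σ P).δ)
    (hC : ∀ P : B12.RunParams, 1 ≤ P.K → Step.InInterval γ P.K (gOfRecord₁₃ F 2 (theta13OfThm1CCMW F 2 j γ ε₀ ε₂₉ B₃ B₃' a₀ a₁) P) →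
      4 * (2 + (121 / 120) ^ 2 * ((σ P).O1 * (σ P).B₃ * (σ P).B₅ * ((theta13OfThm1CCMW F 2 j γ ε₀ ε₂₉ B₃ B₃' a₀ a₁).τ9.M : ℝ) ^ 5)) ≤ (Real.log (γ ^ 2)⁻¹) ^ (Real.log ((σ P).L₀ ^ 2) / Real.log ((F.P P.K).L : ℝ)))
    (hβhist : ∀ P : B12.RunParams, 1 ≤ P.K → Step.InInterval γ P.K (gOfRecord₁₃ F 2 (theta13OfThm1CCMW F 2 j γ ε₀ ε₂₉ B₃ B₃' a₀ a₁) P) → ∀ i, i < P.K - 1 + 1 → 0 ≤ betaOfRecord₁₃ F 2 (theta13OfThm1CCMW F 2 j γ ε₀ ε₂₉ B₃ B₃' a₀ a₁) i (prefixOf (gOfRecord₁₃ F 2 (theta13OfThm1CCMW F 2 j γ ε₀ ε₂₉ B₃ B₃' a₀ a₁) P) i))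
    (hMl : ∀ P : B12.RunParams, 1 ≤ P.K → Step.InInterval γ P.K (gOfRecord₁₃ F 2 (theta13OfThm1CCMW F 2 j γ ε₀ ε₂₉ B₃ B₃' a₀ a₁) P) → (121 / 120) ^ 2 * ((σ P).O1 * (σ P).B₃ * (σ P).B₅ * ((theta13OfThm1CCMW F 2 j γ ε₀ ε₂₉ B₃ B₃' a₀ a₁).τ9.M : ℝ) ^ 5) * Real.exp (-(4 * (σ P).δ * ((theta13OfThm1CCMW F 2 j γ ε₀ ε₂₉ B₃ B₃' a₀ a₁).τ9.M : ℝ))) ≤ 1 / 12)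
    (hΛ : ∀ P : B12.RunParams, 1 ≤ P.K → Step.InInterval γ P.K (gOfRecord₁₃ F 2 (theta13OfThm1CCMW F 2 j γ ε₀ ε₂₉ B₃ B₃' a₀ a₁) P) → (((enlD F (theta13OfThm1CCMW F 2 j γ ε₀ ε₂₉ B₃ B₃' a₀ a₁).ν (theta13OfThm1CCMW F 2 j γ ε₀ ε₂₉ B₃ B₃' a₀ a₁).τ9.M P (gOfRecord₁₃ F 2 (theta13OfThm1CCMW F 2 j γ ε₀ ε₂₉ B₃ B₃' a₀ a₁) P)) 4 (P.K - 1 + 1 + 1 - (N0OfRecord₁₃ (theta13OfThm1CCMW F 2 j γ ε₀ ε₂₉ B₃ B₃' a₀ a₁) P (P.K - 1 + 1)))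
        (omegaOfChain (s P) (P.K - 1 + 1 + 1 - (N0OfRecord₁₃ (theta13OfThm1CCMW F 2 j γ ε₀ ε₂₉ B₃ B₃' a₀ a₁) P (P.K - 1 + 1)))))ᶜ ∩ (σ P).Z).Nonempty)
    (L91h : ∀ P : B12.RunParams, 1 ≤ P.K → Step.InInterval γ P.K (gOfRecord₁₃ F 2 (theta13OfThm1CCMW F 2 j γ ε₀ ε₂₉ B₃ B₃' a₀ a₁) P) → ∀ U, new189 (D P) U → ∀ p ∈ plaqsOf (half (D P)),
      Ineq191 (dist1 (plaqHol ((D P).Upp U) p)) ((D P).devV'' U p) (D P).α (((D P).L ^ (D P).h)⁻¹) ((D P).ε (D P).h) (E124 (D P).ε (D P).L (D P).η (D P).k (D P).h))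
    (L95 : ∀ P : B12.RunParams, 1 ≤ P.K → Step.InInterval γ P.K (gOfRecord₁₃ F 2 (theta13OfThm1CCMW F 2 j γ ε₀ ε₂₉ B₃ B₃' a₀ a₁) P) → ∀ U, new189 (D P) U → ∀ p ∈ plaqsOf (half (D P)),
      Ineq195 ((D P).devV'' U p) (dist1 (plaqHol ((D P).Uhalf U ((D P).boxOf p)) p)) (D P).α (((D P).L ^ (D P).h)⁻¹) ((D P).ε (D P).h) (E124 (D P).ε (D P).L (D P).η (D P).k (D P).h))
    (L91 : ∀ P : B12.RunParams, 1 ≤ P.K → Step.InInterval γ P.K (gOfRecord₁₃ F 2 (theta13OfThm1CCMW F 2 j γ ε₀ ε₂₉ B₃ B₃' a₀ a₁) P) → ∀ U, new189 (D P) U → ∀ i, (D P).h ≤ i → i ≤ (D P).k → ∀ p ∈ plaqsOf (dom (D P) i),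
      Ineq191 (dist1 (plaqHol ((D P).Upp U) p)) ((D P).dev97 U p) (D P).α (((D P).L ^ i)⁻¹) ((D P).ε i) (E124 (D P).ε (D P).L (D P).η (D P).k i))
    (L97 : ∀ P : B12.RunParams, 1 ≤ P.K → Step.InInterval γ P.K (gOfRecord₁₃ F 2 (theta13OfThm1CCMW F 2 j γ ε₀ ε₂₉ B₃ B₃' a₀ a₁) P) → ∀ U, new189 (D P) U → ∀ i, (D P).h ≤ i → i ≤ (D P).k → ∀ p ∈ plaqsOf (dom (D P) i),
      Ineq191 ((D P).dev97 U p) ((D P).dev0 U p) (D P).α (((D P).L ^ i)⁻¹) ((D P).ε i) (E124 (D P).ε (D P).L (D P).η (D P).k i))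
    (L80 : ∀ P : B12.RunParams, 1 ≤ P.K → Step.InInterval γ P.K (gOfRecord₁₃ F 2 (theta13OfThm1CCMW F 2 j γ ε₀ ε₂₉ B₃ B₃' a₀ a₁) P) → ∀ U, new189 (D P) U → ∀ i, (D P).h ≤ i → i ≤ (D P).k → ∀ p ∈ plaqsOf (dom (D P) i),
      Ineq180 ((D P).dev0 U p) ((D P).ε (D P).k) (D P).η (D P).B₃ (D P).B₅ (D P).M (D P).δ ((D P).dist p) (D P).O1)
    -- dag-n12-w5's endpoint `B15Prop1EndpointFromWindowDirectPackage` ON THE RUN's LATTICE, per run `P` and instance family `ι P` (every letter of the endpoint displayed per run;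
    -- `hfar` from the knit's box letter `hZ1` by `far_letter_of_box`, the [15] torus-class letter from `h15` by `thm1TorusClass_of_variationalThm1RegSepCoP7M`)
    (hd3 : ∀ P : B12.RunParams, 3 ≤ (F.P P.K).d) (h0 : ∀ P : B12.RunParams, 0 < (F.P P.K).d) (ι : B12.RunParams → Type)
    (Z Λ : ∀ P : B12.RunParams, ι P → Set (Site (F.P P.K) 0)) (k : ∀ P : B12.RunParams, ι P → ℕ) (M : ∀ P : B12.RunParams, ι P → ℝ) (hk0 : ∀ (P : B12.RunParams) (i : ι P), 0 < k P i) (hk : ∀ (P : B12.RunParams) (i : ι P), k P i ≤ (F.P P.K).m + (F.P P.K).K)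
    (eR : ∀ P : B12.RunParams, ι P → ℝ) (heR : ∀ (P : B12.RunParams) (i : ι P), 0 < eR P i)
    (T : ∀ (P : B12.RunParams) (i : ι P), Finset (PBond (F.P P.K) (k P i)))
    (lo hi : ∀ P : B12.RunParams, ι P → Fin (F.P P.K).d → ℤ) (n : ∀ P : B12.RunParams, ι P → ℕ) (hn : ∀ (P : B12.RunParams) (i : ι P) κ, hi P i κ ≤ lo P i κ + n P i) (hN : ∀ (P : B12.RunParams) (i : ι P), n P i + 2 < (F.P P.K).sitesPerDir (k P i))
    (hbox : ∀ (P : B12.RunParams) (i : ι P), pts (k P i) (Λ P i) = (castSite '' Set.Icc (lo P i) (hi P i) : Set (Site (F.P P.K) (k P i))))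
    (hZ : ∀ (P : B12.RunParams) (i : ι P), (boxPlaqs (lo P i - 1) (hi P i + 1) : Set (Plaq (F.P P.K) (k P i))) ⊆ plaqsInside (pts (k P i) (Z P i)))
    (hTG0 : ∀ (P : B12.RunParams) (i : ι P), T P i = (box (fun κ => (hi P i κ - lo P i κ + 1).toNat) (lo P i)).image fun x =>
      (⟨castSite (x - unitVec ⟨0, h0 P⟩), ⟨0, h0 P⟩⟩ : PBond (F.P P.K) (k P i)))
    (hN5 : ∀ (P : B12.RunParams) (i : ι P) κ, ((hi P i κ - lo P i κ + 1).toNat : ℤ) + 5 < (F.P P.K).sitesPerDir (k P i))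
    (Kb : ∀ P : B12.RunParams, ι P → ℕ) (hK1 : ∀ (P : B12.RunParams) (i : ι P), 1 ≤ Kb P i) (hKn : ∀ (P : B12.RunParams) (i : ι P) κ, (hi P i κ - lo P i κ + 1).toNat ≤ Kb P i)
    (ext : ∀ (P : B12.RunParams) (i : ι P), GaugeField (F.P P.K) (k P i) SU2 → GaugeField (F.P P.K) (k P i) SU2)
    (hext : ∀ (P : B12.RunParams) (i : ι P) Vk, ext P i Vk = extend (pts (k P i) (Λ P i)) (shellGauge Vk (lo P i) (hi P i)) Vk)
    (hlohi : ∀ (P : B12.RunParams) (i : ι P), lo P i ≤ hi P i)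
    -- the REGION parallelepipeds of the normalisation and the datum tolerances
    (LO HI : ∀ P : B12.RunParams, ι P → Fin (F.P P.K).d → ℤ) (hLO : ∀ (P : B12.RunParams) (i : ι P), LO P i ≤ lo P i - 1) (hHI : ∀ (P : B12.RunParams) (i : ι P), hi P i + 1 ≤ HI P i) (n' : ∀ P : B12.RunParams, ι P → ℕ) (hn' : ∀ (P : B12.RunParams) (i : ι P) κ, HI P i κ ≤ LO P i κ + n' P i)
    (hn'N : ∀ (P : B12.RunParams) (i : ι P), n' P i < (F.P P.K).sitesPerDir (k P i)) (hR' : ∀ (P : B12.RunParams) (i : ι P), (boxPlaqs (LO P i) (HI P i) : Set (Plaq (F.P P.K) (k P i))) ⊆ plaqsInside (pts (k P i) (Z P i)))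
    (ρn : ∀ P : B12.RunParams, ι P → ℝ)
    (hρn : ∀ (P : B12.RunParams) (i : ι P), (((F.P P.K).d : ℝ) * n' P i + 1) * ((((F.P P.K).d - 1 : ℕ) : ℝ) * n' P i * ((12 * (F.P P.K).d * (n P i + 2) ^ 2 + 1) * eR P i)
      + 3 * (F.P P.K).d * (n P i + 2) ^ 2 * eR P i) ≤ ρn P i)
    {γ₈ cJ bx : B12.RunParams → ℝ} (hγ : ∀ P : B12.RunParams, 0 < γ₈ P) (hcJ : ∀ P : B12.RunParams, 0 ≤ cJ P) (hbx : ∀ P : B12.RunParams, 0 ≤ bx P)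
    (hbxM : ∀ (P : B12.RunParams) (i : ι P), 12 * ((F.P P.K).d : ℝ) * ((n P i : ℝ) + 2) ^ 2 ≤ bx P * (M P i) ^ 2)
    {R 𝓐₀ : ∀ P : B12.RunParams, ι P → ℝ} (hM : ∀ (P : B12.RunParams) (i : ι P), 1 ≤ (M P i)) (hR : ∀ (P : B12.RunParams) (i : ι P), 0 < R P i)
    -- (J0′), R-EXPLICIT: per instance one radius and one bound for every base field of the strict guard
    (hMin : ∀ (P : B12.RunParams) (i : ι P) Vk, PlaqSmallOn (plaqsInside (pts (k P i) (Z P i ∩ (Λ P i)ᶜ))) (eR P i) Vk →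
      ∃ Ũ : VecField (F.P P.K) (k P i) (EuclideanSpace ℂ (Fin 3)) × VecField (F.P P.K) (k P i) (EuclideanSpace ℂ (Fin 3)) →
          PBond (F.P P.K) 0 → Matrix (Fin 2) (Fin 2) ℂ,
        (∀ b a c, DifferentiableOn ℂ (fun z => Ũ z b a c) (ball 0 (R P i))) ∧
        (∀ z ∈ ball (0 : VecField (F.P P.K) (k P i) (EuclideanSpace ℂ (Fin 3)) × VecField (F.P P.K) (k P i) (EuclideanSpace ℂ (Fin 3))) (R P i),
          ∀ b a c, ‖Ũ z b a c‖ ≤ 𝓐₀ P i) ∧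
        ∀ p B' : VecField (F.P P.K) (k P i) E3, ‖p‖ < R P i → ‖B'‖ < R P i → ∃ U' : GaugeField (F.P P.K) 0 SU2,
          (∀ b, Ũ (cplxVec p, cplxVec B') b = ((U' b : SU2) : Matrix (Fin 2) (Fin 2) ℂ)) ∧
            IsMinimizer (Node00.avOfRecord F 2 P.K) (Node00.regMSCoPOfRecord F 2 (theta13OfThm1CCMW F 2 j γ ε₀ ε₂₉ B₃ B₃' a₀ a₁).ν P.K (k P i) (maxDomT (theta13OfThm1CCMW F 2 j γ ε₀ ε₂₉ B₃ B₃' a₀ a₁).ν.M₁ (Z P i))) (Bj (theta13OfThm1CCMW F 2 j γ ε₀ ε₂₉ B₃ B₃' a₀ a₁).ν.M₁ (Z P i) (k P i))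
              (avgFamily (Node00.avOfRecord F 2 P.K) (qsstarGIter0 (k P i) (expMul su2Chart B' (ext P i (expMul su2Chart p Vk))))) U')
    {γc : B12.RunParams → ℝ} (hγc : ∀ P : B12.RunParams, 0 ≤ γc P)
    -- (WD) THE WINDOW∕DIRECT LETTER PACKAGE per instance (p646359 §5's `hWD` verbatim), asked ONLY at the guarded base fields whose extended datum is `ρn i`-near `1` on the region box
    {δc εc μc Kc τc : ∀ P : B12.RunParams, ι P → ℝ} (hδc0 : ∀ (P : B12.RunParams) (i : ι P), 0 ≤ δc P i) (hεc0 : ∀ (P : B12.RunParams) (i : ι P), 0 ≤ εc P i) (hμc0 : ∀ (P : B12.RunParams) (i : ι P), 0 ≤ μc P i)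
    (hWD : ∀ (P : B12.RunParams) (i : ι P) (Vk : GaugeField (F.P P.K) (k P i) SU2), PlaqSmallOn (plaqsInside (pts (k P i) (Z P i ∩ (Λ P i)ᶜ))) (eR P i) Vk →
      (∀ b ∈ (boxBonds (LO P i) (HI P i) : Set (PBond (F.P P.K) (k P i))), dist1 (ext P i Vk b) ≤ ρn P i) →
      ∃ (U₀ : GaugeField (F.P P.K) 0 SU2) (Xf : GaugeSlice (pts (k P i) (Λ P i)) (T P i) E3 → PBond (F.P P.K) 0 → lieSU (Fin 2)) (W : Finset (Plaq (F.P P.K) 0)),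
        -- C1_window
        (∀ p ∈ W, ‖((U₀ ⟨p.src, p.μ⟩ : SU2) : Matrix (Fin 2) (Fin 2) ℂ) - 1‖ ≤ δc P i ∧ ‖((U₀ ⟨p.src.shift p.μ, p.ν⟩ : SU2) : Matrix (Fin 2) (Fin 2) ℂ) - 1‖ ≤ δc P i ∧
            ‖((U₀ ⟨p.src.shift p.ν, p.μ⟩ : SU2) : Matrix (Fin 2) (Fin 2) ℂ) - 1‖ ≤ δc P i ∧ ‖((U₀ ⟨p.src, p.ν⟩ : SU2) : Matrix (Fin 2) (Fin 2) ℂ) - 1‖ ≤ δc P i) ∧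
        -- P1
        (∀ p ∉ W, ((⟨p.src, p.μ⟩ : PBond (F.P P.K) 0) ∈ {b : PBond (F.P P.K) 0 | b.src ∈ maxDomT (theta13OfThm1CCMW F 2 j γ ε₀ ε₂₉ B₃ B₃' a₀ a₁).ν.M₁ (Z P i) 1} ∨
            (⟨p.src.shift p.μ, p.ν⟩ : PBond (F.P P.K) 0) ∈ {b : PBond (F.P P.K) 0 | b.src ∈ maxDomT (theta13OfThm1CCMW F 2 j γ ε₀ ε₂₉ B₃ B₃' a₀ a₁).ν.M₁ (Z P i) 1} ∨
            (⟨p.src.shift p.ν, p.μ⟩ : PBond (F.P P.K) 0) ∈ {b : PBond (F.P P.K) 0 | b.src ∈ maxDomT (theta13OfThm1CCMW F 2 j γ ε₀ ε₂₉ B₃ B₃' a₀ a₁).ν.M₁ (Z P i) 1} ∨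
            (⟨p.src, p.ν⟩ : PBond (F.P P.K) 0) ∈ {b : PBond (F.P P.K) 0 | b.src ∈ maxDomT (theta13OfThm1CCMW F 2 j γ ε₀ ε₂₉ B₃ B₃' a₀ a₁).ν.M₁ (Z P i) 1}) →
          ‖((GaugeField.plaqHol U₀ p : SU2) : Matrix (Fin 2) (Fin 2) ℂ) - 1‖ ≤ εc P i) ∧
        Xf 0 = 0 ∧ ContDiffAt ℝ 2 Xf 0 ∧
        (∀ᶠ Y in 𝓝 (0 : GaugeSlice (pts (k P i) (Λ P i)) (T P i) E3),
          IsMinimizer (Node00.avOfRecord F 2 P.K) (Node00.regMSCoPOfRecord F 2 (theta13OfThm1CCMW F 2 j γ ε₀ ε₂₉ B₃ B₃' a₀ a₁).ν P.K (k P i) (maxDomT (theta13OfThm1CCMW F 2 j γ ε₀ ε₂₉ B₃ B₃' a₀ a₁).ν.M₁ (Z P i))) (Bj (theta13OfThm1CCMW F 2 j γ ε₀ ε₂₉ B₃ B₃' a₀ a₁).ν.M₁ (Z P i) (k P i))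
            (avgFamily (Node00.avOfRecord F 2 P.K) (qsstarGIter0 (k P i) (expMul su2Chart (ιA (pts (k P i) (Λ P i)) (T P i) Y) (ext P i Vk)))) (expChart U₀ (Xf Y))) ∧
        ∃ (Ψ₂ : (PBond (F.P P.K) 0 → lieSU (Fin 2)) →L[ℝ] (PBond (F.P P.K) 0 → lieSU (Fin 2)) →L[ℝ] (Fin (constrCard (Bj (theta13OfThm1CCMW F 2 j γ ε₀ ε₂₉ B₃ B₃' a₀ a₁).ν.M₁ (Z P i) (k P i)) (k P i)) → lieSU (Fin 2)))
          (lam : (Fin (constrCard (Bj (theta13OfThm1CCMW F 2 j γ ε₀ ε₂₉ B₃ B₃' a₀ a₁).ν.M₁ (Z P i) (k P i)) (k P i)) → lieSU (Fin 2)) →L[ℝ] ℝ)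
          (p : Seminorm ℝ (PBond (F.P P.K) 0 → lieSU (Fin 2))),
          HasFDerivAt (fun Y => fderiv ℝ (msChart F 2 P.K (k P i) (Bj (theta13OfThm1CCMW F 2 j γ ε₀ ε₂₉ B₃ B₃' a₀ a₁).ν.M₁ (Z P i) (k P i)) (avgFamily (Node00.avOfRecord F 2 P.K) (qsstarGIter0 (k P i) (ext P i Vk))) U₀) Y) Ψ₂ 0 ∧
          (∀ᶠ Y in 𝓝 (0 : PBond (F.P P.K) 0 → lieSU (Fin 2)),
            DifferentiableAt ℝ (msChart F 2 P.K (k P i) (Bj (theta13OfThm1CCMW F 2 j γ ε₀ ε₂₉ B₃ B₃' a₀ a₁).ν.M₁ (Z P i) (k P i)) (avgFamily (Node00.avOfRecord F 2 P.K) (qsstarGIter0 (k P i) (ext P i Vk))) U₀) Y) ∧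
          fderiv ℝ (fun Y : PBond (F.P P.K) 0 → lieSU (Fin 2) => wilsonAction4 (expChart U₀ Y)) 0 =
            lam.comp (fderiv ℝ (msChart F 2 P.K (k P i) (Bj (theta13OfThm1CCMW F 2 j γ ε₀ ε₂₉ B₃ B₃' a₀ a₁).ν.M₁ (Z P i) (k P i)) (avgFamily (Node00.avOfRecord F 2 P.K) (qsstarGIter0 (k P i) (ext P i Vk))) U₀) 0) ∧
          (∀ Y : PBond (F.P P.K) 0 → lieSU (Fin 2), ∑ b, ‖(Y b : Matrix (Fin 2) (Fin 2) ℂ)‖ ^ 2 ≤ p Y ^ 2) ∧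
          ∀ X : GaugeSlice (pts (k P i) (Λ P i)) (T P i) E3,
            lam (Ψ₂ (fderiv ℝ Xf 0 X) (fderiv ℝ Xf 0 X)) ≤ μc P i * p (fderiv ℝ Xf 0 X) ^ 2 ∧
            p (fderiv ℝ Xf 0 X) ≤ Kc P i * ‖X‖ ∧
            γc P * (∑ z ∈ box (fun κ => (hi P i κ - lo P i κ + 1).toNat + 3) (fun κ => lo P i κ - 2), ∑ μ : Fin (F.P P.K).d, ∑ a : Fin 3,
                  curl (fun b => ιA (pts (k P i) (Λ P i)) (T P i) X (⟨castSite b.1, b.2⟩ : PBond (F.P P.K) (k P i)) a) z ⟨0, h0 P⟩ μ ^ 2) - τc P i * ‖X‖ ^ 2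
              ≤ ((Fintype.card (Fin 2) : ℝ)⁻¹ • ∑ p ∈ W, (innerSL ℝ (E := lieSU (Fin 2))).bilinearComp
              (ContinuousLinearMap.proj (R := ℝ) (φ := fun _ : PBond (F.P P.K) 0 => lieSU (Fin 2)) (⟨p.src, p.μ⟩ : PBond (F.P P.K) 0) + ContinuousLinearMap.proj (R := ℝ) (φ := fun _ : PBond (F.P P.K) 0 => lieSU (Fin 2)) (⟨p.src.shift p.μ, p.ν⟩ : PBond (F.P P.K) 0)
                - ContinuousLinearMap.proj (R := ℝ) (φ := fun _ : PBond (F.P P.K) 0 => lieSU (Fin 2)) (⟨p.src.shift p.ν, p.μ⟩ : PBond (F.P P.K) 0) - ContinuousLinearMap.proj (R := ℝ) (φ := fun _ : PBond (F.P P.K) 0 => lieSU (Fin 2)) (⟨p.src, p.ν⟩ : PBond (F.P P.K) 0))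
              (ContinuousLinearMap.proj (R := ℝ) (φ := fun _ : PBond (F.P P.K) 0 => lieSU (Fin 2)) (⟨p.src, p.μ⟩ : PBond (F.P P.K) 0) + ContinuousLinearMap.proj (R := ℝ) (φ := fun _ : PBond (F.P P.K) 0 => lieSU (Fin 2)) (⟨p.src.shift p.μ, p.ν⟩ : PBond (F.P P.K) 0)
                - ContinuousLinearMap.proj (R := ℝ) (φ := fun _ : PBond (F.P P.K) 0 => lieSU (Fin 2)) (⟨p.src.shift p.ν, p.μ⟩ : PBond (F.P P.K) 0) - ContinuousLinearMap.proj (R := ℝ) (φ := fun _ : PBond (F.P P.K) 0 => lieSU (Fin 2)) (⟨p.src, p.ν⟩ : PBond (F.P P.K) 0))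
              : (PBond (F.P P.K) 0 → lieSU (Fin 2)) →L[ℝ] (PBond (F.P P.K) 0 → lieSU (Fin 2)) →L[ℝ] ℝ) (fderiv ℝ Xf 0 X) (fderiv ℝ Xf 0 X))
    -- numerics: the assembled DIRECT `Cerr i` is small, and the positivity constant fits
    (hsm : ∀ (P : B12.RunParams) (i : ι P), (32 * (((F.P P.K).d : ℝ) - 1) * δc P i + 8 * (((F.P P.K).d : ℝ) - 1) * εc P i + μc P i) * Kc P i ^ 2 + τc P i
      ≤ γc P / (2 * (3 * (Kb P i : ℝ) ^ 2 + 2 * (Kb P i : ℝ) ^ 4)))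
    (hγle : ∀ (P : B12.RunParams) (i : ι P), γ₈ P / (M P i) ^ 5 ≤ γc P / (2 * (3 * (Kb P i : ℝ) ^ 2 + 2 * (Kb P i : ℝ) ^ 4)))
    -- the geometric letter: every fine site whose k-block label lies in the box `[lo − 1, hi + 1]` lies in `Ω₁(Z)` (print: `Λ` deep inside `Z`); dag-n12-c's `far_letter_of_box` turns it into the bond letter `hfar`
    (hZ1 : ∀ (P : B12.RunParams) (i : ι P) (y : Site (F.P P.K) 0), B14.Eq22Determines.blockIter (k P i) y ∈ (castSite '' Set.Icc (lo P i - 1) (hi P i + 1) : Set (Site (F.P P.K) (k P i))) → y ∈ maxDomT (theta13OfThm1CCMW F 2 j γ ε₀ ε₂₉ B₃ B₃' a₀ a₁).ν.M₁ (Z P i) 1)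
    (hZblk : ∀ (P : B12.RunParams) (i : ι P), IsBlockUnion (k P i) (Z P i))
    (hdiv : ∀ (P : B12.RunParams) (i : ι P), side (F.P P.K).L (theta13OfThm1CCMW F 2 j γ ε₀ ε₂₉ B₃ B₃' a₀ a₁).ν.M₁ (k P i) ∣ (F.P P.K).sitesPerDir 0)
    {cE cA : B12.RunParams → ℝ} (hcE0 : ∀ P : B12.RunParams, 0 ≤ cE P) (hcE : ∀ (P : B12.RunParams) (i : ι P), 12 * ((F.P P.K).d : ℝ) * ((n P i : ℝ) + 2) ^ 2 ≤ cE P)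
    (heRa : ∀ (P : B12.RunParams) (i : ι P), (cE P + 1) * eR P i ≤ a₁ ∧ B₃ * ((cE P + 1) * eR P i) ≤ (theta13OfThm1CCMW F 2 j γ ε₀ ε₂₉ B₃ B₃' a₀ a₁).ν.εreg)
    (hcA : ∀ P : B12.RunParams, 1 / 2 * (B₃ * (cE P + 1) * (F.P P.K).eta 1 ^ 2) ^ 2 * (Fintype.card (Plaq (F.P P.K) 0) : ℝ) ≤ cA P)
    (hcJ' : ∀ (P : B12.RunParams) (i : ι P), 2 * cA P * eR P i / R P i + 4 * ((Fintype.card (Plaq (F.P P.K) 0) : ℝ) * (1 + 8 * 𝓐₀ P i ^ 4)) / (R P i * eR P i) ≤ cJ P)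
    (h15 : VariationalThm1RegSepCoP7M F 2 B₃ a₀ a₁) (hj : 1 ≤ j) :
    ∃ γ₁₂ : ℝ, 0 < γ₁₂ ∧ ∃ lamW : ResidW F 2, ∀ P : B12.RunParams, lamW.kSel P < P.K → Step.InInterval γ₁₂ P.K (gOfRecord₁₃ F 2 (theta13OfThm1CCMW F 2 j γ ε₀ ε₂₉ B₃ B₃' a₀ a₁) P) →
        B15Leaf (WOfRecord₁₃ F 2 (theta13OfThm1CCMW F 2 j γ ε₀ ε₂₉ B₃ B₃' a₀ a₁) lamW P) := by
  -- `2 ≤ M₁ = L^j` at the window-edition witness (`1 ≤ j`, `1 < L`); `εreg = a₀` (`rfl`)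
  have h2 : 2 ≤ F.L ^ j :=
    calc 2 ≤ F.L := F.hL.2
      _ = F.L ^ 1 := (pow_one _).symm
      _ ≤ F.L ^ j := Nat.pow_le_pow_right (Nat.zero_lt_of_lt F.hL.2) hj
  choose areg hapos hrow using fun P : B12.RunParams =>
    exists_domain_prop1Printed_lfVarOn_std_su2_box_intrinsic_analytic_atZSeqCoPRecord_ofThm1TorusClass_ofMinimiserFamily_ofWindowDirectPackage_ofCoercive (F := F) (theta13OfThm1CCMW F 2 j γ ε₀ ε₂₉ B₃ B₃' a₀ a₁).ν P.K (hd3 P) (h0 P)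
      (Z := Z P) (Λ := Λ P) (k := k P) (M := M P) (hk0 := hk0 P) (hk := hk P) (eR := eR P) (heR := heR P) (T := T P) (lo := lo P) (hi := hi P) (n := n P) (hn := hn P)
      (hN := hN P) (hbox := hbox P) (hZ := hZ P) (hTG0 := hTG0 P) (hN5 := hN5 P) (K := Kb P) (hK1 := hK1 P) (hKn := hKn P) (ext := ext P) (hext := hext P) (hlohi := hlohi P)
      (LO := LO P) (HI := HI P) (hLO := hLO P) (hHI := hHI P) (n' := n' P) (hn' := hn' P) (hn'N := hn'N P) (hR' := hR' P) (ρn := ρn P) (hρn := hρn P) (hγ := hγ P)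
      (hcJ := hcJ P) (hbx := hbx P) (hbxM := hbxM P) (hM := hM P) (hR := hR P) (hMin := hMin P) (hγ₀ := hγc P) (hδc0 := hδc0 P) (hεc0 := hεc0 P) (hμc0 := hμc0 P)
      (hWD := hWD P) (hsm := hsm P) (hγle := hγle P) (hfar := fun i b hb => far_letter_of_box (hbox P i) (hZ1 P i) b hb) (hZblk := hZblk P) (hM2 := h2) (hdiv := hdiv P)
      (hcE0 := hcE0 P) (hcE := hcE P) (hB₃ := hB) (heRa := heRa P) (ha₀ := le_of_eq rfl) (hcA := hcA P) (h15T := thm1TorusClass_of_variationalThm1RegSepCoP7M (theta13OfThm1CCMW F 2 j γ ε₀ ε₂₉ B₃ B₃' a₀ a₁).ν P.K h15)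
      (hcJ' := hcJ' P)
  -- 12Zᴳ-W §2 at the LF-pinned base layer, its Prop-1 row fed
  exact exists_gamma_residW_b15Leaf_window_theta13OfThm1CCMW_topLevel_pinnedΛΩχZ_of_massLive
    { lam with LF := fun P => lfVarOn su2Chart fun i => InstOn.std (Node00.bgMSCoPOfRecord F 2 (theta13OfThm1CCMW F 2 j γ ε₀ ε₂₉ B₃ B₃' a₀ a₁).ν P.K (k P i) (maxDomT (theta13OfThm1CCMW F 2 j γ ε₀ ε₂₉ B₃ B₃' a₀ a₁).ν.M₁ (Z P i))) (theta13OfThm1CCMW F 2 j γ ε₀ ε₂₉ B₃ B₃' a₀ a₁).ν.M₁ (Z P i) (Λ P i) (k P i) (M P i) (areg P i) (anExt (pts (k P i) (Λ P i)) (T P i) (fun177std (Node00.bgMSCoPOfRecord F 2 (theta13OfThm1CCMW F 2 j γ ε₀ ε₂₉ B₃ B₃' a₀ a₁).ν P.K (k P i) (maxDomT (theta13OfThm1CCMW F 2 j γ ε₀ ε₂₉ B₃ B₃' a₀ a₁).ν.M₁ (Z P i))) (theta13OfThm1CCMW F 2 j γ ε₀ ε₂₉ B₃ B₃' a₀ a₁).ν.M₁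 (Z P i) (k P i)) (ext P i) (min (1 / 2) (min (R P i / 8) (γ₈ P / (M P i) ^ 5 * (R P i / 2) ^ 2 / (48 * (4 * ((Fintype.card (Plaq (F.P P.K) 0) : ℝ) * (1 + 8 * 𝓐₀ P i ^ 4)) / R P i + 1)))))) }
    σ s Nm p₁ hγ₀ hγh hB hB' ha₀ ha₁ hbox' hβ' hγe D hD hmassLive (fun P _ _ => hrow P) hNN hNk hβ0 hβ hL₀ hL₀L hOB hδ hC hβhist hMl hΛ L91h L95 L91 L97 L80

end WindowRoadPinLF

end Summit.QuantumFields.YangMills.BalabanUVNodes.N12AtTheta13OfThm1CCMWGenericDoorWindowGuardPinLFWindowDirect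

end
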